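import Summits.BirchSwinnertonDyer.BirchSwinnertonDyer.Theorems.AlignedTransportAtTwoMainConjectureOfRankZeroBSDAtTwoSelmerLayerSplit
import Summits.BirchSwinnertonDyer.BirchSwinnertonDyer.Theorems.AlignedTransportAtTwoMainConjectureOfRankZeroBSDAtTwoCyclotomicLayerPrime
import Literature.NumberTheory.EllipticCurves.IwasawaAlgebraSpecializationTorsionBoundFamilyProofs
import Literature.NumberTheory.EllipticCurves.IwasawaAlgebraRankOneIdealProofs
import Literature.NumberTheory.EllipticCurves.SelmerCorankControlRatOrdinaryProofs
import HarnessLib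

/-!
# Route `AlignedTransportAtTwo`, crux C2 `MainConjectureOfRankZeroBSDAtTwo` (stmt-BirchSwinnertonDyer-22298):
# THE SELMER-LEVEL GROWTH DICHOTOMY — `Ψ_{n+1} ∣ char_Λ X(E/K_∞)` as soon as the `p^∞`-SELMER corank grows from `K_n` to
# `K_{n+1}` (Ш counts), modulo Greenberg's `ker g_n` at the LOWER layer only; unconditionally from
# `corank Sel_{p^∞}(E_{K_{n+1}}/K_{n+1}) > rank_{ℤ_p} X/ω_nX`

HONEST FRAMING (cell `bsd-f1-sign2`, WIDTH-5 attached prover seat `bsd-line-att-p5` gen 40 on line `birth` of the lead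
`bsd-line-att-p2`; `--supports` stmt-BirchSwinnertonDyer-22298, closes nothing; BSD is NOT proved by any of this; the crux
C2, its verdict «blocked-on `Rank1Residual.GreenbergMuConjectureIrreducible`» and every registered stub are untouched).
THEOREMS ONLY — no `def`, no instance, no named fact, no `sorry`. g39's successor (iii): «Ш-inclusive versions of the g35/g37
half-doors need a SELMER-level growth dichotomy (`Ψ_n ∣ f_X` from corank growth)». The lineage's RANK version (g36
`…CyclotomicLayerRankGrowth/Dichotomy`: a Mordell–Weil jump in `K_{n+1}/K_n` puts `Ψ_{n+1} = Φ_{p^{n+1}}(1+T)` into `char_Λ X`)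
counts independent Kummer classes; the Selmer version goes through the dual side: by `…SelmerLayerSplit` a Selmer-corank jump is
`rank_{ℤ_p} X/Ψ_{n+1}X > 0`, and

* §1 (pure `Λ`-algebra) `lambdaInvariant_eq_zero_of_natCast_pow_smul_eq_zero` (`ℚ_p ⊗ M = 0` if `p^N M = 0`);
  ★★ `dvd_of_mem_charIdeal_of_lambdaInvariant_quotient_pos` — **for a finitely generated torsion `Λ`-module `M` and `P` prime in `Λ`:
  `rank_{ℤ_p} M/PM > 0 ⟹ P ∣ g` for every `g ∈ char_Λ M`** (if `Ann M ⊄ (P)`, some `s ∈ Ann M` with `P ∤ s` gives `p^N ∈ (s, P)`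
  (`finite_quotient_span_pair_of_prime`, `exists_natCast_pow_mem_of_finite_quotient`), so `p^N` kills `M/PM`; otherwise `(P)` is in
  the support, `length_{(P)} ≥ 1`, and g36's `coe_pow_dvd_of_mem_charIdeal_of_le_lengthAt` applies);
* §2 (Selmer; any number field, any `ℤ_p`-extension with topological generator, `X` f.g. TORSION)
  ★★ `cyclotomicLayer_dvd_of_mem_charIdeal_of_lambdaInvariant_layerQuotient_lt_selmerCorank` — **UNCONDITIONAL:
  `rank_{ℤ_p} X/ω_nX < corank Sel_{p^∞}(E_{K_{n+1}}/K_{n+1}) ⟹ Ψ_{n+1} ∣ g` for all `g ∈ char_Λ X`**;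
  ★★★ `cyclotomicLayer_dvd_of_mem_charIdeal_of_selmerCorank_layer_lt_of_finite_kerG` — **`corank Sel_{p^∞}(E_{K_n}/K_n) <
  corank Sel_{p^∞}(E_{K_{n+1}}/K_{n+1})` and `ker g_n` finite ⟹ `Ψ_{n+1} ∣ char_Λ X`** (the Ш-INCLUSIVE growth dichotomy; over `ℚ`
  the input is Lemma 3.4 at the LOWER layer `n` only — at `n = 0` it is PROVED for good ordinary `p`, §3);
* §3 (`K = ℚ`, good ordinary `p`, `n = 0`) ★★★ `xi_dvd_of_mem_charIdeal_of_selmerCorank_lt_layer_one` — **UNCONDITIONAL: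
  `corank Sel_{p^∞}(E/ℚ) < corank Sel_{p^∞}(E_{ℚ_1}/ℚ_1) ⟹ ξ_p = Φ_p(1+T) ∣ char_Λ X`** (layer-0 control over `ℚ`,
  `Greenberg1999_coinvariantsRank_eq_selmerCorank_rat_holds`).

References: R. Greenberg, LNM 1716 (1999), Thm. 1.2, §3, §5 p. 132 [GreenbergLNM1716]; L. Washington, GTM 83, §13.2 [Washington1997];
N. Bourbaki, AC VII §4.4.
-/

set_option linter.dupNamespace false
set_option autoImplicit false

noncomputable section

open scoped Classical AddSubgroup TensorProduct Polynomial

universe u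

namespace Summit.BirchSwinnertonDyer.BirchSwinnertonDyer.Theorems.AlignedTransportAtTwoSelmerLayerGrowthDichotomy

open Polynomial WeierstrassCurve Literature.NumberTheory.EllipticCurves Literature.NumberTheory.EllipticCurves.IwasawaDual
  Summit.BirchSwinnertonDyer.BirchSwinnertonDyer.Theorems.AlignedTransportAtTwoSelmerLayerModel
  Summit.BirchSwinnertonDyer.BirchSwinnertonDyer.Theorems.AlignedTransportAtTwoSelmerLayerDuality
  Summit.BirchSwinnertonDyer.BirchSwinnertonDyer.Theorems.AlignedTransportAtTwoSelmerLayerControl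
  Summit.BirchSwinnertonDyer.BirchSwinnertonDyer.Theorems.AlignedTransportAtTwoSelmerLayerSplit
  Summit.BirchSwinnertonDyer.BirchSwinnertonDyer.Theorems.AlignedTransportAtTwoCyclotomicLayerPrime

/-! ## §1 `rank_{ℤ_p} M/PM > 0 ⟹ P ∣ char_Λ M` -/

section Algebra

variable (p : ℕ) [hp : Fact p.Prime]

/-- **`dim_{ℚ_p} ℚ_p ⊗_{ℤ_p} M = 0` when `p^N · M = 0`** (`q ⊗ m = p^{−N}q ⊗ p^N m = 0`). [folklore] -/
theorem lambdaInvariant_eq_zero_of_natCast_pow_smul_eq_zero (M : Type*) [AddCommGroup M] [Module (IwasawaAlgebra p) M] (N : ℕ)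
    (h : ∀ m : M, ((p : ℕ) : IwasawaAlgebra p) ^ N • m = 0) : lambdaInvariant p M = 0 := by
  have hsub : Subsingleton (ℚ_[p] ⊗[ℤ_[p]] RestrictScalars ℤ_[p] (IwasawaAlgebra p) M) := by
    refine ⟨fun x y ↦ ?_⟩
    suffices hz : ∀ z : ℚ_[p] ⊗[ℤ_[p]] RestrictScalars ℤ_[p] (IwasawaAlgebra p) M, z = 0 by rw [hz x, hz y]
    intro z
    induction z using TensorProduct.induction_on with
    | zero => rfl
    | tmul q m =>
      have hpN : ((p : ℚ_[p]) ^ N) ≠ 0 := pow_ne_zero _ (by exact_mod_cast hp.out.ne_zero)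
      have hq : ((p : ℤ_[p]) ^ N) • (q * ((p : ℚ_[p]) ^ N)⁻¹) = q := by
        rw [Algebra.smul_def, map_pow, map_natCast, mul_comm, mul_assoc, inv_mul_cancel₀ hpN, mul_one]
      have hm : ((p : ℤ_[p]) ^ N) • (m : RestrictScalars ℤ_[p] (IwasawaAlgebra p) M) = 0 := by
        rw [RestrictScalars.smul_def, map_pow, map_natCast]
        exact h m
      rw [← hq, TensorProduct.smul_tmul, hm, TensorProduct.tmul_zero]
    | add x y hx hy => rw [hx, hy, add_zero]
  exact Module.finrank_zero_of_subsingleton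

/-- ★★ **`rank_{ℤ_p} M/PM > 0 ⟹ P ∣ g` for every `g ∈ char_Λ M`** (`M` a finitely generated torsion `Λ`-module, `P ∈ ℤ_p[X]` prime in
`Λ` — e.g. `Ψ_{n+1} = Φ_{p^{n+1}}(1+T)`): either `Ann_Λ M ⊆ (P)`, so `(P)` lies in the support of `M`, `length_{(P)} M_{(P)} ≥ 1` and
g36's `coe_pow_dvd_of_mem_charIdeal_of_le_lengthAt` gives `P ∣ g`; or some `s ∈ Ann M` has `P ∤ s`, then `Λ/(s, P)` is finite
(`finite_quotient_span_pair_of_prime`), `p^N ∈ (s, P)` (`exists_natCast_pow_mem_of_finite_quotient`), `p^N M ⊆ PM` and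
`rank_{ℤ_p} M/PM = 0`. [cite: Washington1997, §13.2] [cite: GreenbergLNM1716, §5 p. 132] -/
theorem dvd_of_mem_charIdeal_of_lambdaInvariant_quotient_pos {P : ℤ_[p][X]} (hPr : Prime (P : PowerSeries ℤ_[p]))
    (M : Type u) [AddCommGroup M] [Module (IwasawaAlgebra p) M] [Module.Finite (IwasawaAlgebra p) M]
    (hM : Module.IsTorsion (IwasawaAlgebra p) M)
    (hpos : 0 < lambdaInvariant p (M ⧸ (Ideal.span {(P : PowerSeries ℤ_[p])} • ⊤ : Submodule (IwasawaAlgebra p) M)))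
    {g : IwasawaAlgebra p} (hg : g ∈ Module.charIdeal (IwasawaAlgebra p) M) : (P : PowerSeries ℤ_[p]) ∣ g := by
  obtain ⟨𝔭, h𝔭⟩ : ∃ 𝔭 : PrimeSpectrum (IwasawaAlgebra p), 𝔭.asIdeal = Ideal.span {(P : PowerSeries ℤ_[p])} :=
    ⟨⟨Ideal.span {(P : PowerSeries ℤ_[p])}, isPrime_span_coe hPr⟩, rfl⟩
  -- `Ann M ⊆ (P)`
  have hann : Module.annihilator (IwasawaAlgebra p) M ≤ 𝔭.asIdeal := by
    intro s hs
    rw [h𝔭]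
    by_contra hsP
    have hndvd : ¬ (P : PowerSeries ℤ_[p]) ∣ s := fun hd ↦ hsP (Ideal.mem_span_singleton.mpr hd)
    haveI := IwasawaAlgebra.finite_quotient_span_pair_of_prime (p := p) hPr hndvd
    obtain ⟨N, hN⟩ := IwasawaAlgebra.exists_natCast_pow_mem_of_finite_quotient (p := p)
      (Ideal.span ({s, (P : PowerSeries ℤ_[p])} : Set _))
    obtain ⟨a, b, hab⟩ := Ideal.mem_span_pair.mp hN
    have hkill : ∀ q : M ⧸ (Ideal.span {(P : PowerSeries ℤ_[p])} • ⊤ : Submodule (IwasawaAlgebra p) M),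
        ((p : ℕ) : IwasawaAlgebra p) ^ N • q = 0 := by
      intro q
      induction q using Submodule.Quotient.induction_on with
      | H m =>
        rw [← Submodule.Quotient.mk_smul, Submodule.Quotient.mk_eq_zero, ← hab, add_smul, mul_smul, mul_smul,
          Module.mem_annihilator.mp hs m, smul_zero, zero_add]
        exact Submodule.smul_mem _ b (Submodule.smul_mem_smul (Ideal.mem_span_singleton_self _) Submodule.mem_top)
    have h0 := lambdaInvariant_eq_zero_of_natCast_pow_smul_eq_zero p _ N hkill
    omega
  -- `(P)` is in the support: `length ≥ 1`
  have hsupp : 𝔭 ∈ Module.support (IwasawaAlgebra p) M := Module.mem_support_iff_of_finite.mpr hann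
  haveI : Nontrivial (LocalizedModule 𝔭.asIdeal.primeCompl M) := Module.mem_support_iff.mp hsupp
  have h1 : ((1 : ℕ) : ℕ∞) ≤ Literature.NumberTheory.EllipticCurves.Module.lengthAt (IwasawaAlgebra p) M 𝔭 := by
    rw [Nat.cast_one]
    exact Order.one_le_iff_pos.mpr Module.length_pos
  have h := coe_pow_dvd_of_mem_charIdeal_of_le_lengthAt hPr 𝔭 h𝔭 M hM hg h1
  rwa [pow_one] at h

end Algebra

/-! ## §2 The Selmer-level growth dichotomy -/

section Selmer

variable {K : Type u} [Field K] [NumberField K] (W : WeierstrassCurve K) {p : ℕ} [hp : Fact p.Prime]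
  (κ : ZpExtension K p) {γ : Field.absoluteGaloisGroup K}

/-- **`rank_{ℤ_p} X/Ψ_{n+1}X > 0 ⟹ Ψ_{n+1} ∣ char_Λ X`** (`X = D.X` finitely generated torsion; `Ψ_{n+1} = Φ_{p^{n+1}}(1+T)` is prime in
`Λ`, g36 / cell `bsd-ssimc`; its geometric-sum spelling is `coe_cyclotomicLayer_eq_sum`). [cite: Washington1997, §13.2] -/
theorem cyclotomicLayer_dvd_of_mem_charIdeal_of_lambdaInvariant_cyclotomicFactor_pos (D : W.SelmerDualData κ γ)
    [Module.Finite (IwasawaAlgebra p) D.X] (hD : D.IsTorsion) (n : ℕ)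
    (hpos : 0 < lambdaInvariant p (D.X ⧸ (Ideal.span
      {(∑ i ∈ Finset.range p, ((1 + PowerSeries.X : PowerSeries ℤ_[p]) ^ (p ^ n)) ^ i : IwasawaAlgebra p)} •
        ⊤ : Submodule (IwasawaAlgebra p) D.X)))
    {g : IwasawaAlgebra p} (hg : g ∈ D.charIdeal) :
    (((cyclotomic (p ^ (n + 1)) ℤ_[p]).comp (Polynomial.X + 1) : ℤ_[p][X]) : PowerSeries ℤ_[p]) ∣ g := by
  refine dvd_of_mem_charIdeal_of_lambdaInvariant_quotient_pos p (DefectPrime.prime_coe_cyclotomic_comp p n) D.X hD ?_ hg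
  rw [coe_cyclotomicLayer_eq_sum]
  exact hpos

/-- Restatement helper: `Ψ_{n+1} ∣ f` when `char_Λ X = (f)`. [folklore] -/
theorem cyclotomicLayer_dvd_of_charIdeal_eq_span_of_lambdaInvariant_cyclotomicFactor_pos (D : W.SelmerDualData κ γ)
    [Module.Finite (IwasawaAlgebra p) D.X] (hD : D.IsTorsion) (n : ℕ) {f : IwasawaAlgebra p} (hf : D.charIdeal = Ideal.span {f})
    (hpos : 0 < lambdaInvariant p (D.X ⧸ (Ideal.span
      {(∑ i ∈ Finset.range p, ((1 + PowerSeries.X : PowerSeries ℤ_[p]) ^ (p ^ n)) ^ i : IwasawaAlgebra p)} •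
        ⊤ : Submodule (IwasawaAlgebra p) D.X))) :
    (((cyclotomic (p ^ (n + 1)) ℤ_[p]).comp (Polynomial.X + 1) : ℤ_[p][X]) : PowerSeries ℤ_[p]) ∣ f :=
  cyclotomicLayer_dvd_of_mem_charIdeal_of_lambdaInvariant_cyclotomicFactor_pos W κ D hD n hpos
    (by rw [hf]; exact Ideal.mem_span_singleton_self f)

/-- ★★ **UNCONDITIONAL: `rank_{ℤ_p} X/ω_nX < corank Sel_{p^∞}(E_{K_{n+1}}/K_{n+1}) ⟹ Ψ_{n+1} ∣ char_Λ X`** (any number field, any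
`ℤ_p`-extension with topological generator, `X` f.g. torsion): Lemma 3.1 at layer `n+1` and the layer split give
`rank X/Ψ_{n+1}X > 0` (`…SelmerLayerSplit.lambdaInvariant_cyclotomicFactor_pos_of_selmerCorank_layer_lt`), then §1.
[cite: GreenbergLNM1716, §3 Lemma 3.1, §5 p. 132] -/
theorem cyclotomicLayer_dvd_of_mem_charIdeal_of_lambdaInvariant_layerQuotient_lt_selmerCorank [W.IsElliptic] (hγ : κ.IsTopGenerator γ)
    (D : W.SelmerDualData κ γ) [Module.Finite (IwasawaAlgebra p) D.X] (hD : D.IsTorsion) (n : ℕ)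
    (h : lambdaInvariant p (D.X ⧸ (Ideal.span {((1 + PowerSeries.X : PowerSeries ℤ_[p]) ^ (p ^ n) - 1 : IwasawaAlgebra p)} •
        ⊤ : Submodule (IwasawaAlgebra p) D.X)) < (W.baseChange (κ.layer (n + 1))).selmerCorank p)
    {g : IwasawaAlgebra p} (hg : g ∈ D.charIdeal) :
    (((cyclotomic (p ^ (n + 1)) ℤ_[p]).comp (Polynomial.X + 1) : ℤ_[p][X]) : PowerSeries ℤ_[p]) ∣ g :=
  cyclotomicLayer_dvd_of_mem_charIdeal_of_lambdaInvariant_cyclotomicFactor_pos W κ D hD n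
    (lambdaInvariant_cyclotomicFactor_pos_of_selmerCorank_layer_lt W κ hγ D n h) hg

/-- ★★★ **THE Ш-INCLUSIVE GROWTH DICHOTOMY: a jump of the `p^∞`-Selmer corank from `K_n` to `K_{n+1}` puts `Ψ_{n+1} = Φ_{p^{n+1}}(1+T)`
into `char_Λ X(E/K_∞)`, as soon as Greenberg's `ker g_n` is finite at the LOWER layer** (then `corank Sel_{p^∞}(E_{K_n}/K_n) =
rank X/ω_nX`, `…SelmerLayerControl`; no hypothesis at the layer `n+1`). Either the Selmer corank is stationary in `K_{n+1}/K_n`, or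
`Ψ_{n+1} ∣ f_X`. [cite: GreenbergLNM1716, Thm 1.2, §3, §5 p. 132] -/
theorem cyclotomicLayer_dvd_of_mem_charIdeal_of_selmerCorank_layer_lt_of_finite_kerG [W.IsElliptic] (hγ : κ.IsTopGenerator γ)
    (D : W.SelmerDualData κ γ) [Module.Finite (IwasawaAlgebra p) D.X] (hD : D.IsTorsion) (n : ℕ) [Finite (W.KerG κ n)]
    (h : (W.baseChange (κ.layer n)).selmerCorank p < (W.baseChange (κ.layer (n + 1))).selmerCorank p)
    {g : IwasawaAlgebra p} (hg : g ∈ D.charIdeal) :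
    (((cyclotomic (p ^ (n + 1)) ℤ_[p]).comp (Polynomial.X + 1) : ℤ_[p][X]) : PowerSeries ℤ_[p]) ∣ g := by
  rw [selmerCorank_layer_eq_lambdaInvariant_layerQuotient_of_finite_kerG W κ hγ D n] at h
  exact cyclotomicLayer_dvd_of_mem_charIdeal_of_lambdaInvariant_layerQuotient_lt_selmerCorank W κ hγ D hD n h hg

/-- The dichotomy form: with `ker g_n` finite, **either `corank Sel_{p^∞}(E_{K_{n+1}}/K_{n+1}) ≤ corank Sel_{p^∞}(E_{K_n}/K_n)` or
`Ψ_{n+1} ∣ f_X`** (`char_Λ X = (f_X)`). [cite: GreenbergLNM1716, §5 p. 132] -/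
theorem selmerCorank_layer_succ_le_or_cyclotomicLayer_dvd_of_finite_kerG [W.IsElliptic] (hγ : κ.IsTopGenerator γ)
    (D : W.SelmerDualData κ γ) [Module.Finite (IwasawaAlgebra p) D.X] (hD : D.IsTorsion) (n : ℕ) [Finite (W.KerG κ n)]
    {f : IwasawaAlgebra p} (hf : D.charIdeal = Ideal.span {f}) :
    (W.baseChange (κ.layer (n + 1))).selmerCorank p ≤ (W.baseChange (κ.layer n)).selmerCorank p ∨
      (((cyclotomic (p ^ (n + 1)) ℤ_[p]).comp (Polynomial.X + 1) : ℤ_[p][X]) : PowerSeries ℤ_[p]) ∣ f := by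
  by_cases h : (W.baseChange (κ.layer n)).selmerCorank p < (W.baseChange (κ.layer (n + 1))).selmerCorank p
  · exact Or.inr (cyclotomicLayer_dvd_of_mem_charIdeal_of_selmerCorank_layer_lt_of_finite_kerG W κ hγ D hD n h
      (by rw [hf]; exact Ideal.mem_span_singleton_self f))
  · exact Or.inl (not_lt.mp h)

end Selmer

/-! ## §3 Over `ℚ`, first layer: unconditional -/

section RatLayerOne

variable (W : WeierstrassCurve ℚ) [W.IsElliptic] [W.IsGloballyMinimal] {p : ℕ} [hp : Fact p.Prime]
  {κ : ZpExtension ℚ p} {γ : Field.absoluteGaloisGroup ℚ}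

/-- ★★★ **UNCONDITIONAL FIRST-LAYER GROWTH DICHOTOMY over `ℚ`**: for `W/ℚ` globally minimal with good ordinary reduction at `p`,
the cyclotomic `ℤ_p`-extension with topological generator `γ`, and a dual datum with `X` torsion: if
`corank Sel_{p^∞}(E/ℚ) < corank Sel_{p^∞}(E_{ℚ_1}/ℚ_1)` (e.g. new points OR new Ш over the first layer `ℚ_1`), then
`ξ_p = Φ_p(1+T) ∣ char_Λ X` (`ker g_0` is finite over `ℚ`: Lemma 3.4 at `n = 0` is PROVED,
`Greenberg1999_coinvariantsRank_eq_selmerCorank_rat_holds`; the base-layer Selmer group is `Sel_{p^∞}(E/ℚ)` up to g39's model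
identification, here read through `W.selmerCorank p = rank X/TX`). [cite: GreenbergLNM1716, Thm 1.2, §5 p. 132] -/
theorem cyclotomicLayer_one_dvd_of_mem_charIdeal_of_selmerCorank_lt_layer_one (hgood : W.HasGoodReductionAtPrime p)
    (hord : ¬ (p : ℤ) ∣ W.frobeniusTrace p) (hκ : κ.IsCyclotomic) (hγ : κ.IsTopGenerator γ) (D : W.SelmerDualData κ γ)
    (hD : D.IsTorsion) (h : W.selmerCorank p < (W.baseChange (κ.layer 1)).selmerCorank p)
    {g : IwasawaAlgebra p} (hg : g ∈ D.charIdeal) :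
    (((cyclotomic (p ^ (0 + 1)) ℤ_[p]).comp (Polynomial.X + 1) : ℤ_[p][X]) : PowerSeries ℤ_[p]) ∣ g := by
  haveI : Module.Finite (IwasawaAlgebra p) D.X := SelmerDualData.module_finite_of_isCyclotomic W κ hκ D hγ
  have h0 : IwasawaAlgebra.coinvariantsRank p D.X = W.selmerCorank p :=
    (Greenberg1999_coinvariantsRank_eq_selmerCorank_rat_holds W p hgood hord κ γ hκ hγ D).2
  refine cyclotomicLayer_dvd_of_mem_charIdeal_of_lambdaInvariant_layerQuotient_lt_selmerCorank W κ hγ D hD 0 ?_ hg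
  -- `rank X/ω_0X = rank X/TX = coinvariantsRank`
  have e : Ideal.span {((1 + PowerSeries.X : PowerSeries ℤ_[p]) ^ (p ^ 0) - 1 : IwasawaAlgebra p)} • (⊤ : Submodule (IwasawaAlgebra p) D.X) =
      Ideal.span {(PowerSeries.X : IwasawaAlgebra p)} • ⊤ := by
    rw [pow_zero, pow_one, add_sub_cancel_left]
  rw [lambdaInvariant_eq_of_linearEquiv (Submodule.quotEquivOfEq _ _ e)]
  change IwasawaAlgebra.coinvariantsRank p D.X < _
  rwa [h0]

end RatLayerOne

end Summit.BirchSwinnertonDyer.BirchSwinnertonDyer.Theorems.AlignedTransportAtTwoSelmerLayerGrowthDichotomy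

end
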